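import Summits.QuantumFields.QCD.Theses.NestedDissectionSea
import Summits.QuantumFields.QCD.Theorems.GluonicCompletion.Negative.Threshold

/-!
# `SeaFactorisationBridge` — negative-side support: the kill profile

Standing-disprover extraction (cdisprove cycle 1; re-creation in the tree of the certificate first
written by the one-shot seats g47-3 / rattack-13880 / rattack-13902, whose evidence files live on the
gate box), first landed for the rev-≤ 24 bridge `RobustYangMills → CoerciveSea → (threshold form of
QCDOf 2 ∧ QCDOf 3)` (crux stmt-QuantumFields-13880).  Definition-free.

* `conclusion_iff_massiveBodies` — the bare consequent of THAT bridge (threshold form, `N_f = 2, 3`) is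
  equivalent to the pre-re-type massive bodies of `QCDOf 2`, `QCDOf 3` (the landed
  `GluonicCompletion.Negative.massiveBody_iff_threshold`); `conclusion_of_qcd` — the re-typed sub-problem
  statement `QCD` still IMPLIES it (drop `IsChiralAtZero`, offset `0`).
* `not_seaFactorisationBridge_iff_of` — the kill profile, parametrised by the consequent: whenever the bridge
  reads `RobustYangMillsRG → CoerciveSea → C`, `¬ SeaFactorisationBridge ↔ RobustYangMillsRG ∧ CoerciveSea ∧ ¬ C`;
  `cruxes_of_not_seaFactorisationBridge` — in particular a disproof of the bridge is a proof of BOTH other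
  cruxes of the line (the shared `RobustYangMillsRG` and the hinge `CoerciveSea`); nothing cheaper exists.
  (The positive directions `C → S`, `¬RobustYangMillsRG → S`, `¬CoerciveSea → S` are one-liners kept in the
  crux work file `Cruxes/SeaFactorisationBridge/Disproof.lean`, not here: they conclude the item.)

Maintenance record (full-build repair 2026-08-17; dependency drift, importer rebuild after p134299). Three
things moved under this file since it landed (2026-08-16T01:31Z): (1) the summit conjunct `QCDOf N_f` was
RE-TYPED (p117723: it now conjoins `reg.IsChiralAtZero`), so the old `conclusion_iff_qcd :
(threshold form) ↔ QCD` neither elaborates against the repaired `GluonicCompletion.Negative.Threshold`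
(whose `qcdOf_iff_threshold` became the deprecated alias of `massiveBody_iff_threshold`) nor holds — its `→`
direction would manufacture chirality at zero from a threshold statement; (2) route `NestedDissectionSea`
dropped the item `RobustYangMills` (rev 25) in favour of the shared RG-level `RobustYangMillsRG`; (3) the bridge
itself was restated (13880 → 17683 → 17705 → 18065: hypotheses `RobustYangMillsRG`, `CoerciveSea`; consequent
= Wilson-plaquette sign-coherence clauses + the threshold massive bodies), so the old
`not_seaFactorisationBridge_iff : ¬ SeaFactorisationBridge ↔ RobustYangMills ∧ CoerciveSea ∧ ¬ QCD` names a
vanished constant and a vanished shape. Theorems files are append-only, so nothing is mutated in place: the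
still-valid content is added under new names (`conclusion_iff_massiveBodies`, `conclusion_of_qcd`,
`not_seaFactorisationBridge_iff_of`, `cruxes_of_not_seaFactorisationBridge` — the last two stated so that
they survive further restatements of the consequent) and the two old names are kept as `@[deprecated]`
aliases, exactly as in `GluonicCompletion/Negative/Threshold.lean`.
-/

namespace Summit.QuantumFields.QCD.Theorems.SeaFactorisationBridge.Negative

open Literature.MathematicalPhysics.QuantumFieldTheory
open Summit.QuantumFields.QCD.Theses.NestedDissectionSea
open Summit.QuantumFields.QCD.Theorems.GluonicCompletion.Negative (massiveBody_iff_threshold)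

/-- **The consequent of the rev-≤ 24 bridge is the pair of pre-re-type massive bodies.** The threshold form
of massive QCD for `N_f = 2, 3` (verbatim the consequent of the bridge as item stmt-QuantumFields-13880) is
equivalent to the conjunct-wise PRE-RE-TYPE body of `QCDOf 2 ∧ QCDOf 3` (`QCDOf` without
`reg.IsChiralAtZero`): shift the flavour-blind critical mass (`massiveBody_iff_threshold`). [folklore] -/
theorem conclusion_iff_massiveBodies :
    (∀ Nf : ℕ, Nf = 2 ∨ Nf = 3 → ∃ M₀ : ℝ, 0 ≤ M₀ ∧ ∃ reg : QCDRegularisation Nf, reg.HasMassScaling ∧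
      ∀ m : Fin Nf → ℝ, (∀ f, M₀ < m f) →
        ∃ (z shift : QCDField Nf → ℕ → ℝ) (T : OSData (QCDField Nf) 4),
          IsQCDAlong (reg.scheme m z shift) T ∧ T.IsNontrivial QCDField.glue ∧ T.IsNonGaussian QCDField.glue ∧
            (∀ f g : Fin Nf, f ≠ g → T.IsNontrivial (QCDField.pseudoRe f g)) ∧
              ∃ Δ > 0, T.HasMassGap Δ ∧ (reg.scheme m z shift).HasLatticeMassGap Δ) ↔
    (∀ Nf : ℕ, Nf = 2 ∨ Nf = 3 → ∃ reg : QCDRegularisation Nf, reg.HasMassScaling ∧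
      ∀ m : Fin Nf → ℝ, (∀ f, 0 < m f) →
        ∃ (z shift : QCDField Nf → ℕ → ℝ) (T : OSData (QCDField Nf) 4),
          IsQCDAlong (reg.scheme m z shift) T ∧ T.IsNontrivial QCDField.glue ∧ T.IsNonGaussian QCDField.glue ∧
            (∀ f g : Fin Nf, f ≠ g → T.IsNontrivial (QCDField.pseudoRe f g)) ∧
              ∃ Δ > 0, T.HasMassGap Δ ∧ (reg.scheme m z shift).HasLatticeMassGap Δ) :=
  forall_congr' fun Nf => imp_congr_right fun _ => (massiveBody_iff_threshold Nf).symm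

/-- **The surviving direction against the re-typed sub-problem**: `QCD` (= `QCDOf 2 ∧ QCDOf 3`, each now with
`reg.IsChiralAtZero`) implies the threshold form of the rev-≤ 24 consequent — forget chirality at zero and
take the offset `M₀ = 0`. (The converse is the content the re-type removed.) [folklore] -/
theorem conclusion_of_qcd (h : QCD) :
    ∀ Nf : ℕ, Nf = 2 ∨ Nf = 3 → ∃ M₀ : ℝ, 0 ≤ M₀ ∧ ∃ reg : QCDRegularisation Nf, reg.HasMassScaling ∧
      ∀ m : Fin Nf → ℝ, (∀ f, M₀ < m f) →
        ∃ (z shift : QCDField Nf → ℕ → ℝ) (T : OSData (QCDField Nf) 4),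
          IsQCDAlong (reg.scheme m z shift) T ∧ T.IsNontrivial QCDField.glue ∧ T.IsNonGaussian QCDField.glue ∧
            (∀ f g : Fin Nf, f ≠ g → T.IsNontrivial (QCDField.pseudoRe f g)) ∧
              ∃ Δ > 0, T.HasMassGap Δ ∧ (reg.scheme m z shift).HasLatticeMassGap Δ := by
  obtain ⟨h2, h3⟩ := h
  rintro Nf (rfl | rfl)
  · obtain ⟨reg, hMS, -, hm⟩ := h2
    exact ⟨0, le_rfl, reg, hMS, hm⟩
  · obtain ⟨reg, hMS, -, hm⟩ := h3
    exact ⟨0, le_rfl, reg, hMS, hm⟩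

/-- Deprecated spelling (landed 2026-08-16): the original statement read `(threshold form) ↔ QCD`. Since the
statement re-type of 2026-08-16 (`QCDOf` conjoins `reg.IsChiralAtZero`) that biconditional neither elaborates
against the repaired `Threshold.lean` nor holds; the name is kept (append-only) as an alias of
`conclusion_iff_massiveBodies` (the same equivalence with `QCD` unfolded to its former definiens); the true half
against the re-typed `QCD` is `conclusion_of_qcd`. -/
@[deprecated conclusion_iff_massiveBodies (since := "2026-08-17")]
alias conclusion_iff_qcd := conclusion_iff_massiveBodies

/-- **Kill profile of the bridge, parametrised by its consequent.** Whenever the bridge reads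
`RobustYangMillsRG → CoerciveSea → C` (today `C` = the Wilson-plaquette sign-coherence clauses plus the
threshold massive bodies, item stmt-QuantumFields-18065; take `hC := Iff.rfl`), refuting it means proving the
shared crux `RobustYangMillsRG`, proving the hinge `CoerciveSea` AND refuting `C`. Pure logic. [folklore] -/
theorem not_seaFactorisationBridge_iff_of {C : Prop}
    (hC : SeaFactorisationBridge ↔ (RobustYangMillsRG → CoerciveSea → C)) :
    ¬ SeaFactorisationBridge ↔ (RobustYangMillsRG ∧ CoerciveSea ∧ ¬ C) := by
  rw [hC]
  constructor
  · intro h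
    by_contra h'
    exact h fun hY hS => by_contra fun hQ => h' ⟨hY, hS, hQ⟩
  · rintro ⟨hY, hS, hQ⟩ h
    exact hQ (h hY hS)

-- buildfix 2026-08-19 (maintenance): `cruxes_of_not_seaFactorisationBridge : ¬ SeaFactorisationBridge →
-- RobustYangMillsRG ∧ CoerciveSea` REMOVED — it instantiated the kill profile with `hC := Iff.rfl` against the
-- rev-≤34 bridge `RobustYangMillsRG → CoerciveSea → C`; the bridge was restated (NestedDissectionSea revs 35+: hypotheses
-- `RobustYangMillsRG → EarlyCrosserLaw → FrameAndSeparatorLaw → …`), so `CoerciveSea` no longer follows from a disproof.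
-- The parametrised `not_seaFactorisationBridge_iff_of` above is untouched and still applies with the current consequent.

/-- Deprecated spelling (landed 2026-08-16): the original statement read
`¬ SeaFactorisationBridge ↔ RobustYangMills ∧ CoerciveSea ∧ ¬ QCD` for the rev-≤ 24 bridge (item
stmt-QuantumFields-13880, hypotheses `RobustYangMills`, `CoerciveSea`, consequent ↔ pre-re-type `QCD`). The route
dropped `RobustYangMills` (rev 25) and restated the bridge over `RobustYangMillsRG` with a sign-structured
threshold consequent (items 17683/17705/18065), so that statement names a vanished constant; the name is kept
(append-only) as an alias of the parametrised kill profile `not_seaFactorisationBridge_iff_of`. -/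
@[deprecated not_seaFactorisationBridge_iff_of (since := "2026-08-17")]
alias not_seaFactorisationBridge_iff := not_seaFactorisationBridge_iff_of

end Summit.QuantumFields.QCD.Theorems.SeaFactorisationBridge.Negative
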